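import Mathlib
import Literature.MathematicalPhysics.QuantumFieldTheory.Balaban1983to89.Beta.BlockPoincare

/-!
# `Balaban1983to89.Beta.CoordCubePoincare` — the discrete Poincaré inequality of `Beta/BlockPoincare` in
COORDINATES: on the function cube `Fin d → Fin (n+1)` with the nearest-neighbour bonds `y ↦ y + e_μ`
(β sub-cell, surge node prover #23 gen 3, node 4; journal claim BETA-COORD-CUBE-POINCARE-KERNEL)

HONEST FRAMING (verbatim, page 1 of everything this cell writes): discharging `BetaPertH` makes Bałaban's UV
stability UNCONDITIONAL — a real constructive-QFT result; it is NOT the continuum limit and NOT the Clay problem.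
Gloss (BETA-SPEC v1.9b l. 17–18, G-ref2-14 (a) / G-ref2-20 (a), verbatim): «UNCONDITIONAL» in [Balaban1989LargeFieldII]
(B16, CMP 122) p. 355's interval-hypothesis sense ONLY (`FlowStepRuns.p355Unconditional_of_partialSums` keeps `hnodes`);
the located leaves G-adv3-2 (left inequality of (0.1)/(2.50), d = 4), G-adv3-1 (U2 transfer of B14 Cor. 3's lower
bound) and `SecondExpLeaf` REMAIN.  Gloss 2 (BETA-SPEC v1.9e 22:38Z, beta-ref C-beta-78, BINDING, verbatim): «UNCONDITIONAL» =
`Beta.Assembly.EventualForm`-unconditional — the END statement with the interval hypothesis removed, (0.31) in DEFECTED form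
on all lattices (`PrefixAbsorption.thm2Defected_of_eventualForm`), admissible couplings shrunk to g ≤ g⋆; NOT «B12 Theorem 2 as
printed» (that needs (AF-0s) or (AF-0-L) ∀k at L ≥ L₁ in addition: `eventualForm_not_thm2Printed`, RULING (R6)); never the
continuum limit / mass gap / Clay.  THIS MODULE discharges nothing of that and makes NO UV-stability claim at all: it
is a Mathlib-elementary kernel certificate (v1.1.1/v1.1.2 = v1.1 + this paragraph, docstring-only — beta-ref R129/R150,
ref2 G-ref2-20 (a); no declaration changed).

SCOPE.  THIS MODULE
DISCHARGES NOTHING of the series and asserts NOTHING about Bałaban's papers.  It is the CONSUMER FORM of the kernel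
theorem `BlockPoincare.poincare_cube` (p179450): that theorem is stated on the recursively defined product type
`Cube n d = Fin (n+1) × … × Unit` with the recursively defined bond type `CubeBond n d`; a typer of Bałaban's unit
blocks (pv15's digit charts `Tor M × (Fin d → Fin n) ≃ Tor (fine n M)`, `B5Blocks16.bpt`) meets blocks as FUNCTION
cubes `Fin d → Fin s` with bonds "increase one coordinate by one".  This file supplies exactly that translation, so
that no consumer has to touch the recursive types.  Value = kernel certificate (consumability), NOT summit progress.

WHAT IS PROVED (all `[folklore]`; Mathlib + `Beta/BlockPoincare`):
* `coords n d : Cube n d ≃ (Fin d → Fin (n+1))` — the coordinate chart (`Fin.consEquiv` recursion), with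
  `coords n (d+1) (a, c) = Fin.cons a (coords n d c)` (`coords_succ`).
* `stepUp y μ := Function.update y μ (y μ + 1)` — the neighbour of `y` in direction `μ` (meaningful when
  `y μ ≠ Fin.last n`; at `y μ = last` it wraps and is never used: every sum below is restricted to `y μ ≠ last`).
* `dirichlet_coords` — THE BOND IDENTITY: for every `g : (Fin d → Fin (n+1)) → ℝ`,
  `Σ_{b : CubeBond n d} (g (coords (cubeTgt b)) − g (coords (cubeSrc b)))²
     = Σ_{μ : Fin d} Σ_{y : y μ ≠ last} (g (stepUp y μ) − g y)²`
  (induction on `d`: the horizontal bonds `(i, c)` of `CubeBond n (d+1)` are the direction-`0` steps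
  `cons (castSucc i) p ↦ cons (succ i) p` — `Fin.update_cons_zero`, `Fin.coeSucc_eq_succ`, `Fin.sum_univ_castSucc` —
  and the vertical bonds `(a, b)` are the direction-`succ μ'` steps inside the slice `cons a ·` — `Fin.cons_succ`,
  `Fin.cons_update` and the induction hypothesis applied to `g ∘ cons a`).
* `variance_coords` — `Σ_{x : Cube} (g (coords x) − avg)² = Σ_y (g y − avg univ g)²` (reindexing along the chart).
* **`poincare_coordCube n d g`** — for EVERY `n d` and every `g : (Fin d → Fin (n+1)) → ℝ`:
  `Σ_y (g y − avg univ g)² ≤ (n(n+1)/2) · Σ_μ Σ_{y : y μ ≠ last} (g (stepUp y μ) − g y)²`,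
  the `d`-independent constant of `poincare_cube`; and the mean-free corollary `sum_sq_le_of_sum_eq_zero_coordCube`
  (`Σ_y g y = 0 ⇒ Σ_y g_y² ≤ (n(n+1)/2)·Σ_bonds (δg)²`).
* **`blockPoincare_of_charts`** — the hypothesis `hPoin` of `BlockPoincare.coercive_of_blockPoincare` /
  `coercive_lap_blocks` DISCHARGED FROM CHARTS ALONE: sites `ι` labelled by `blk : ι → β`, bonds `κ` with `src tgt`;
  given for every block `b` a chart `φ b : (Fin d → Fin (n+1)) → ι` (lands in `b`, injective, jointly onto) and a
  listing `ψ b μ y : κ` of the internal steps (`src = φ b y`, `tgt = φ b (stepUp y μ)` for `y μ ≠ last`, injective on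
  those pairs), every block satisfies `Σ_{i ∈ b} (f i − avg_b f)² ≤ (n(n+1)/2) · Σ_{k : src k, tgt k ∈ b} (f (tgt k) − f (src k))²`
  — literally the shape of `hPoin` (block = image of the chart; the listed steps sit injectively inside the block's
  bonds and the remaining bonds only add non-negative terms).
* **`coercive_lap_blocks_of_charts`** — THE PLUG: `BlockPoincare.coercive_lap_blocks` with `hPoin` discharged by
  `blockPoincare_of_charts`; for `H = lap c + Σ_b (a/|b|)·1_b ⊗ 1_b`, `c ≥ γ` on the listed bonds, charts as above and
  any `P ≥ n(n+1)/2`, `P > 0`: `min (γ/P) a · (ω ⬝ᵥ ω) ≤ ω ⬝ᵥ H.mulVec ω`.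
DICTIONARY for the torus typer (prose, nothing of it is typed here): a unit block of the `η = 1/s`-lattice is the
function cube `Fin d → Fin s` (take `n = s − 1`); its internal nearest-neighbour bonds are the pairs `(y, stepUp y μ)`
with `y μ ≠ last`; `coercive_lap_blocks_of_charts` (charts = pv15's digit charts, listing = "the bond leaving `φ b y`
in direction `μ`", `P = (s−1)s/2`, `γ = s²` on nearest-neighbour bonds) gives the coercivity constant
`σ = min (2s/(s−1)) a ≥ min 2 a` for every mesh — the `hpos` of `CombesThomasForm.combesThomas_lattice` /
`CombesThomasFormOp.setDecay_lattice(_dist)`; what remains for the typer is only to exhibit `φ`, `ψ` on `Tor (fine s M)`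
and check the five listed properties and the bond-listing hypotheses `hinj`/`hanti` of `coercive_lap_blocks`.
WHAT IS NOT PROVED: the torus relabelling itself (the block charts of `Tor (fine s M)` and the listing of its bonds);
anything about Bałaban's operators.  References: as in `Beta/BlockPoincare` v1.1 (folklore; tensorisation of
Poincaré inequalities with constant `max`: Bakry–Gentil–Ledoux, *Analysis and Geometry of Markov Diffusion Operators*,
Springer 2014, Prop. 4.3.1 [corpus:book:bakry2013-analysis-geometry-markov-diffusion-operators p0211–p0212]; the
canonical-path method this replaces: F. Martinelli, Saint-Flour 1997, LNM 1717, pp. 93–191, passage at corpus chunks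
p0211–p0212 of [corpus:book:bertoin1999-lectures-probability-theory-statistics], PDF pagination — printed page numbers
differ).  B5 = `Balaban1984PropagatorsI` (1.18) p.20 is context only.
VERSION LOG: v1 p179652 (2026-08-18, commit 845e92fea52c).  v1.1: DOCSTRING-ONLY fix of the reference pointer (v1 wrote
«pp. 211–212 of the volume»; XREAD C-b07g5-2 note N1 on the sibling module); every declaration byte-unchanged.
-/

namespace Literature.MathematicalPhysics.QuantumFieldTheory.Balaban1983to89.Beta.CoordCubePoincare

open Finset Matrix BlockPoincare

noncomputable section

/-- `Cube n 0 = Unit` has exactly one point. [folklore] -/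
instance instUniqueCubeZero (n : ℕ) : Unique (Cube n 0) := inferInstanceAs (Unique Unit)

/-- `CubeBond n 0 = PEmpty` has no bonds. [folklore] -/
instance instIsEmptyCubeBondZero (n : ℕ) : IsEmpty (CubeBond n 0) := inferInstanceAs (IsEmpty PEmpty)

/-- **The coordinate chart** `Cube n d ≃ (Fin d → Fin (n+1))`, by `Fin.consEquiv` recursion. [folklore] -/
def coords (n : ℕ) : (d : ℕ) → Cube n d ≃ (Fin d → Fin (n + 1))
  | 0 => Equiv.ofUnique _ _
  | d + 1 => (Equiv.prodCongr (Equiv.refl (Fin (n + 1))) (coords n d)).trans (Fin.consEquiv fun _ => Fin (n + 1))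

/-- The chart in dimension `d + 1` is `Fin.cons` of the first coordinate and the chart of the rest. [folklore] -/
theorem coords_succ (n d : ℕ) (a : Fin (n + 1)) (c : Cube n d) :
    coords n (d + 1) (a, c) = Fin.cons a (coords n d c) := rfl

/-- The neighbour of `y` in direction `μ`: coordinate `μ` increased by one (used only when `y μ ≠ Fin.last n`).
[folklore] -/
def stepUp {n d : ℕ} (y : Fin d → Fin (n + 1)) (μ : Fin d) : Fin d → Fin (n + 1) :=
  Function.update y μ (y μ + 1)

/-- Direction `0` step of a `cons`-tuple: `stepUp (cons a p) 0 = cons (a + 1) p`. [folklore] -/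
theorem stepUp_cons_zero {n d : ℕ} (a : Fin (n + 1)) (p : Fin d → Fin (n + 1)) :
    stepUp (Fin.cons a p : Fin (d + 1) → Fin (n + 1)) 0 = Fin.cons (a + 1) p := by
  unfold stepUp
  rw [Fin.cons_zero, Fin.update_cons_zero]

/-- Direction `succ μ` step of a `cons`-tuple: `stepUp (cons a p) μ.succ = cons a (stepUp p μ)`. [folklore] -/
theorem stepUp_cons_succ {n d : ℕ} (a : Fin (n + 1)) (p : Fin d → Fin (n + 1)) (μ : Fin d) :
    stepUp (Fin.cons a p : Fin (d + 1) → Fin (n + 1)) μ.succ = Fin.cons a (stepUp p μ) := by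
  unfold stepUp
  rw [Fin.cons_succ, ← Fin.cons_update]

/-- Summing over `a ≠ last` in `Fin (n+1)` is summing over `castSucc i`, `i : Fin n`. [folklore] -/
theorem sum_ite_ne_last {n : ℕ} (h : Fin (n + 1) → ℝ) :
    (∑ a : Fin (n + 1), if a ≠ Fin.last n then h a else 0) = ∑ i : Fin n, h (Fin.castSucc i) := by
  rw [Fin.sum_univ_castSucc]
  simp only [ne_eq, not_true_eq_false, if_false, add_zero]
  refine Finset.sum_congr rfl fun i _ => ?_
  rw [if_pos (Fin.castSucc_lt_last i).ne]

/-- Reindexing a sum over the sites of dimension `d + 1` as a double sum over `cons a p`. [folklore] -/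
theorem sum_cons {n d : ℕ} (G : (Fin (d + 1) → Fin (n + 1)) → ℝ) :
    ∑ y, G y = ∑ a : Fin (n + 1), ∑ p : Fin d → Fin (n + 1), G (Fin.cons a p) := by
  rw [← Fintype.sum_equiv (Fin.consEquiv fun _ => Fin (n + 1)) (fun q => G (Fin.cons q.1 q.2)) G (fun _ => rfl),
    Fintype.sum_prod_type]

/-- **THE BOND IDENTITY**: through the chart, the Dirichlet form over the recursive bond type `CubeBond n d` is the
sum over directions `μ` and sites `y` with `y μ ≠ last` of `(g (y + e_μ) − g y)²`. [folklore] -/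
theorem dirichlet_coords (n : ℕ) : (d : ℕ) → (g : (Fin d → Fin (n + 1)) → ℝ) →
    ∑ b : CubeBond n d, (g (coords n d (cubeTgt n d b)) - g (coords n d (cubeSrc n d b))) ^ 2
      = ∑ μ : Fin d, ∑ y ∈ univ.filter (fun y : Fin d → Fin (n + 1) => y μ ≠ Fin.last n),
          (g (stepUp y μ) - g y) ^ 2
  | 0, g => by simp
  | d + 1, g => by
    have IH := dirichlet_coords n d
    -- the chart of dimension `d + 1`, on the product type
    let E : Fin (n + 1) × Cube n d ≃ (Fin (d + 1) → Fin (n + 1)) :=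
      (Equiv.prodCongr (Equiv.refl (Fin (n + 1))) (coords n d)).trans (Fin.consEquiv fun _ => Fin (n + 1))
    have hE : ∀ a c, E (a, c) = Fin.cons a (coords n d c) := fun a c => rfl
    have hre : ∀ G : (Fin (d + 1) → Fin (n + 1)) → ℝ,
        ∑ y, G y = ∑ a : Fin (n + 1), ∑ c : Cube n d, G (Fin.cons a (coords n d c)) := by
      intro G
      rw [← Fintype.sum_equiv E (fun q => G (Fin.cons q.1 (coords n d q.2))) G (fun _ => rfl),
        Fintype.sum_prod_type]
    -- restate the bond sum over the `Sum` type that `CubeBond n (d+1)` unfolds to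
    show ∑ b : (Fin n × Cube n d) ⊕ (Fin (n + 1) × CubeBond n d),
        (g (E (prodTgt (pathTgt n) (cubeTgt n d) b)) - g (E (prodSrc (pathSrc n) (cubeSrc n d) b))) ^ 2 = _
    rw [Fintype.sum_sum_type, Fin.sum_univ_succ]
    congr 1
    · -- horizontal bonds `(i, c)` = the direction-`0` steps `cons (castSucc i) · ↦ cons (succ i) ·`
      rw [Fintype.sum_prod_type]
      simp only [prodTgt, prodSrc, pathTgt, pathSrc, hE]
      rw [Finset.sum_filter, hre]
      simp only [Fin.cons_zero, stepUp_cons_zero]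
      have key : ∀ c : Cube n d,
          (∑ a : Fin (n + 1), if a ≠ Fin.last n then
              (g (Fin.cons (a + 1) (coords n d c)) - g (Fin.cons a (coords n d c))) ^ 2 else 0)
            = ∑ i : Fin n, (g (Fin.cons i.succ (coords n d c)) - g (Fin.cons i.castSucc (coords n d c))) ^ 2 := by
        intro c
        rw [sum_ite_ne_last (fun a => (g (Fin.cons (a + 1) (coords n d c)) - g (Fin.cons a (coords n d c))) ^ 2)]
        simp only [Fin.coeSucc_eq_succ]
      conv_rhs => rw [Finset.sum_comm]
      simp only [key]
      exact Finset.sum_comm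
    · -- vertical bonds `(a, b)` = the direction-`succ μ` steps inside the slice `cons a ·`
      rw [Fintype.sum_prod_type]
      simp only [prodTgt, prodSrc, hE]
      have hslice : ∀ a : Fin (n + 1),
          ∑ b : CubeBond n d, (g (Fin.cons a (coords n d (cubeTgt n d b)))
              - g (Fin.cons a (coords n d (cubeSrc n d b)))) ^ 2
            = ∑ μ : Fin d, ∑ p ∈ univ.filter (fun p : Fin d → Fin (n + 1) => p μ ≠ Fin.last n),
                (g (Fin.cons a (stepUp p μ)) - g (Fin.cons a p)) ^ 2 :=
        fun a => IH (fun p => g (Fin.cons a p))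
      simp only [hslice]
      rw [Finset.sum_comm]
      refine Finset.sum_congr rfl fun μ _ => ?_
      simp only [Finset.sum_filter]
      rw [sum_cons (fun y : Fin (d + 1) → Fin (n + 1) =>
        if y μ.succ ≠ Fin.last n then (g (stepUp y μ.succ) - g y) ^ 2 else 0)]
      simp only [Fin.cons_succ, stepUp_cons_succ]

/-- Reindexing the variance along the chart. [folklore] -/
theorem variance_coords (n d : ℕ) (g : (Fin d → Fin (n + 1)) → ℝ) :
    variance (g ∘ coords n d) = ∑ y, (g y - avg univ g) ^ 2 := by
  have havg : avg univ (g ∘ coords n d) = avg univ g := by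
    unfold avg
    rw [Finset.card_univ, Finset.card_univ, Fintype.card_congr (coords n d)]
    congr 1
    exact Fintype.sum_equiv (coords n d) _ _ fun i => rfl
  unfold variance
  rw [havg]
  exact Fintype.sum_equiv (coords n d) _ _ fun i => rfl

/-- **THE DISCRETE POINCARÉ INEQUALITY ON THE COORDINATE CUBE** `Fin d → Fin (n+1)`, for EVERY `n` and `d`, with
the `d`-INDEPENDENT constant `n(n+1)/2` of `BlockPoincare.poincare_cube`:
`Σ_y (g y − avg g)² ≤ (n(n+1)/2) · Σ_μ Σ_{y : y μ ≠ last} (g (y + e_μ) − g y)²`. [folklore] -/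
theorem poincare_coordCube (n d : ℕ) (g : (Fin d → Fin (n + 1)) → ℝ) :
    ∑ y, (g y - avg univ g) ^ 2
      ≤ (n : ℝ) * (n + 1) / 2 * ∑ μ : Fin d, ∑ y ∈ univ.filter (fun y : Fin d → Fin (n + 1) => y μ ≠ Fin.last n),
          (g (stepUp y μ) - g y) ^ 2 := by
  have h := poincare_cube n d (g ∘ coords n d)
  rw [variance_coords] at h
  unfold dirichlet at h
  simpa only [Function.comp, dirichlet_coords n d g] using h

/-- Mean-free corollary: if `Σ_y g y = 0` then `Σ_y g_y² ≤ (n(n+1)/2) · Σ_μ Σ_{y μ ≠ last} (g (y + e_μ) − g y)²`.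
[folklore] -/
theorem sum_sq_le_of_sum_eq_zero_coordCube (n d : ℕ) (g : (Fin d → Fin (n + 1)) → ℝ) (hg : ∑ y, g y = 0) :
    ∑ y, g y ^ 2
      ≤ (n : ℝ) * (n + 1) / 2 * ∑ μ : Fin d, ∑ y ∈ univ.filter (fun y : Fin d → Fin (n + 1) => y μ ≠ Fin.last n),
          (g (stepUp y μ) - g y) ^ 2 := by
  have h := poincare_coordCube n d g
  have havg : avg univ g = 0 := by unfold avg; rw [hg, zero_div]
  simpa only [havg, sub_zero] using h

/-- **BLOCK POINCARÉ FROM BLOCK CHARTS** — the hypothesis `hPoin` of `BlockPoincare.coercive_of_blockPoincare` /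
`coercive_lap_blocks`, discharged from charts alone.  Data: sites `ι` with block labels `blk : ι → β`, bonds `κ` with
`src tgt`; for every block `b` a chart `φ b : (Fin d → Fin (n+1)) → ι` onto the block (lands in `b`, injective, jointly
onto) and a bond-listing `ψ b μ y ∈ κ` of the internal steps (`src = φ b y`, `tgt = φ b (y + e_μ)` whenever `y μ ≠ last`,
injective on those pairs).  Conclusion: every block satisfies the Poincaré inequality with the constant `n(n+1)/2`
relative to the bonds with both ends in the block.  Pure bookkeeping over `poincare_coordCube`. [folklore] -/
theorem blockPoincare_of_charts {ι κ β : Type*} [Fintype ι] [Fintype κ] [DecidableEq ι] [DecidableEq κ]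
    [DecidableEq β] (blk : ι → β) (src tgt : κ → ι) (n d : ℕ)
    (φ : β → (Fin d → Fin (n + 1)) → ι) (hφblk : ∀ b y, blk (φ b y) = b)
    (hφinj : ∀ b, Function.Injective (φ b)) (hφsurj : ∀ i, ∃ y, φ (blk i) y = i)
    (ψ : β → Fin d → (Fin d → Fin (n + 1)) → κ)
    (hψsrc : ∀ b μ y, y μ ≠ Fin.last n → src (ψ b μ y) = φ b y)
    (hψtgt : ∀ b μ y, y μ ≠ Fin.last n → tgt (ψ b μ y) = φ b (stepUp y μ))
    (hψinj : ∀ b, Set.InjOn (fun p : Fin d × (Fin d → Fin (n + 1)) => ψ b p.1 p.2)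
      {p | p.2 p.1 ≠ Fin.last n})
    (b : β) (f : ι → ℝ) :
    ∑ i ∈ univ.filter (fun i => blk i = b), (f i - avg (univ.filter fun i => blk i = b) f) ^ 2
      ≤ (n : ℝ) * (n + 1) / 2 *
        ∑ k ∈ univ.filter (fun k => blk (src k) = b ∧ blk (tgt k) = b), (f (tgt k) - f (src k)) ^ 2 := by
  classical
  -- the block is the image of its chart
  have hblock : univ.filter (fun i => blk i = b) = univ.image (φ b) := by
    ext i
    simp only [Finset.mem_filter, Finset.mem_univ, true_and, Finset.mem_image]
    constructor
    · rintro rfl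
      exact hφsurj i
    · rintro ⟨y, rfl⟩
      exact hφblk b y
  have hsumφ : ∀ F : ι → ℝ, ∑ i ∈ univ.filter (fun i => blk i = b), F i = ∑ y, F (φ b y) := by
    intro F
    rw [hblock, Finset.sum_image fun y _ y' _ h => hφinj b h]
  have havg : avg (univ.filter fun i => blk i = b) f = avg univ (f ∘ φ b) := by
    unfold avg
    rw [hsumφ, hblock, Finset.card_image_of_injective _ (hφinj b)]
    rfl
  -- left side = the variance of `f ∘ φ b` on the coordinate cube
  rw [hsumφ, havg]
  refine (poincare_coordCube n d (f ∘ φ b)).trans ?_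
  refine mul_le_mul_of_nonneg_left ?_ (by positivity)
  -- right side: the internal steps, listed injectively by `ψ b`, sit inside the block's bonds
  set S : Finset (Fin d × (Fin d → Fin (n + 1))) := univ.filter (fun p => p.2 p.1 ≠ Fin.last n) with hS
  have hlhs : (∑ μ : Fin d, ∑ y ∈ univ.filter (fun y : Fin d → Fin (n + 1) => y μ ≠ Fin.last n),
        ((f ∘ φ b) (stepUp y μ) - (f ∘ φ b) y) ^ 2)
      = ∑ p ∈ S, (f (tgt (ψ b p.1 p.2)) - f (src (ψ b p.1 p.2))) ^ 2 := by
    rw [hS, Finset.sum_filter, Fintype.sum_prod_type]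
    refine Finset.sum_congr rfl fun μ _ => ?_
    rw [Finset.sum_filter]
    refine Finset.sum_congr rfl fun y _ => ?_
    by_cases hy : y μ ≠ Fin.last n
    · rw [if_pos hy, if_pos hy, hψsrc b μ y hy, hψtgt b μ y hy]
      rfl
    · rw [if_neg hy, if_neg hy]
  rw [hlhs, ← Finset.sum_image (f := fun k => (f (tgt k) - f (src k)) ^ 2)
    (fun p hp p' hp' h => hψinj b (by simpa [hS] using hp) (by simpa [hS] using hp') h)]
  refine Finset.sum_le_sum_of_subset_of_nonneg ?_ fun k _ _ => sq_nonneg _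
  intro k hk
  simp only [Finset.mem_image] at hk
  obtain ⟨p, hp, rfl⟩ := hk
  have hp' : p.2 p.1 ≠ Fin.last n := by simpa [hS] using hp
  simp only [Finset.mem_filter, Finset.mem_univ, true_and]
  rw [hψsrc b p.1 p.2 hp', hψtgt b p.1 p.2 hp', hφblk, hφblk]
  exact ⟨rfl, rfl⟩

/-- **COERCIVITY FROM CHARTS — the plug.**  `BlockPoincare.coercive_lap_blocks` with its block-Poincaré hypothesis
`hPoin` discharged by `blockPoincare_of_charts`: for `H = lap c + Σ_b (a/|b|)·1_b ⊗ 1_b` with `c ≥ γ ≥ 0` on injectively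
listed, never-reversed bonds, `c ≥ 0` symmetric, blocks charted by function cubes `Fin d → Fin (n+1)` as above and any
`P ≥ n(n+1)/2`, `P > 0`: `min (γ/P) a · ‖ω‖² ≤ ⟨ω, Hω⟩`.  (Unit blocks of side `s = n + 1 ≥ 2` of the `η = 1/s` lattice:
`γ = s²`, `P = (s−1)s/2`, so the constant is `min (2s/(s−1)) a ≥ min 2 a` for every mesh.) [folklore] -/
theorem coercive_lap_blocks_of_charts {ι κ β : Type*} [Fintype ι] [Fintype κ] [Fintype β] [DecidableEq ι]
    [DecidableEq κ] [DecidableEq β] (c : ι → ι → ℝ) (hcs : ∀ j k, c j k = c k j) (hc0 : ∀ j k, 0 ≤ c j k)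
    (blk : ι → β) (src tgt : κ → ι) (γ a P : ℝ) (hγ0 : 0 ≤ γ) (ha : 0 ≤ a) (hP : 0 < P)
    (hγ : ∀ k, γ ≤ c (src k) (tgt k)) (hinj : Function.Injective fun k => (src k, tgt k))
    (hanti : ∀ k k', (src k, tgt k) ≠ (tgt k', src k'))
    (n d : ℕ) (hnP : (n : ℝ) * (n + 1) / 2 ≤ P)
    (φ : β → (Fin d → Fin (n + 1)) → ι) (hφblk : ∀ b y, blk (φ b y) = b)
    (hφinj : ∀ b, Function.Injective (φ b)) (hφsurj : ∀ i, ∃ y, φ (blk i) y = i)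
    (ψ : β → Fin d → (Fin d → Fin (n + 1)) → κ)
    (hψsrc : ∀ b μ y, y μ ≠ Fin.last n → src (ψ b μ y) = φ b y)
    (hψtgt : ∀ b μ y, y μ ≠ Fin.last n → tgt (ψ b μ y) = φ b (stepUp y μ))
    (hψinj : ∀ b, Set.InjOn (fun p : Fin d × (Fin d → Fin (n + 1)) => ψ b p.1 p.2)
      {p | p.2 p.1 ≠ Fin.last n})
    (H : Matrix ι ι ℝ)
    (hH : ∀ j k, H j k = CombesThomasForm.lap c j k
      + ∑ b, a / ((univ.filter fun i => blk i = b).card : ℝ)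
          * ((if blk j = b then (1 : ℝ) else 0) * (if blk k = b then (1 : ℝ) else 0)))
    (ω : ι → ℝ) : min (γ / P) a * (ω ⬝ᵥ ω) ≤ ω ⬝ᵥ H.mulVec ω := by
  refine coercive_lap_blocks c hcs hc0 blk src tgt γ a P hγ0 ha hP hγ hinj hanti (fun b f => ?_) H hH ω
  refine (blockPoincare_of_charts blk src tgt n d φ hφblk hφinj hφsurj ψ hψsrc hψtgt hψinj b f).trans ?_
  exact mul_le_mul_of_nonneg_right hnP (Finset.sum_nonneg fun _ _ => sq_nonneg _)

/-- Sanity instance (`n = 1`, `d = 2`, the unit square `{0,1}²` with its 4 bonds): the constant is `1·2/2 = 1`. -/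
example (g : (Fin 2 → Fin 2) → ℝ) :
    ∑ y, (g y - avg univ g) ^ 2
      ≤ (1 : ℝ) * (1 + 1) / 2 * ∑ μ : Fin 2, ∑ y ∈ univ.filter (fun y : Fin 2 → Fin 2 => y μ ≠ Fin.last 1),
          (g (stepUp y μ) - g y) ^ 2 := by
  exact_mod_cast poincare_coordCube 1 2 g

end

end Literature.MathematicalPhysics.QuantumFieldTheory.Balaban1983to89.Beta.CoordCubePoincare
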